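import Summits.Ventures.HSemireg.Pad4TowerClassScreen
import Summits.Ventures.HSemireg.Pad4TowerPsi
import Summits.Ventures.HSemireg.Pad4TowerCrossPhase

/-!
# Venture HSemireg — PAD-4: KERNEL LEMMA Ψ ⊂ (A1) (part 2 of 2) — on 𝔅(μ₄) the class screen forces the Ψ-row and the
# encoder's Ψ-clause; on FILE A designs the class condition forces `Design.PsiBalanced` (the named Ψ-row hypothesis of
# LEMMA Ψ₁ is discharged by (A1))

HONEST FRAMING. Lean index of the computation cell `pub-hsemireg` (S4-PUSH, H2 door PAD-4), typed by the Ventures-side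
typer `hodge-lit-semireg-typer-2` (g4; line of record stmt-HodgeConjecture-18881 `Cruxes/BlochSeedDiscOne/Lines/birth.lean`
814a6a70c14e831a, stub `stub_rung_pad4_seedAt`, screen (H1); card v4.9 row W13 (B)). Sequel of `Pad4TowerClassScreen` (the
pad4lib class frame, the class screen (A1), the functional `Λ₁₂ = 12Λ`, `Λ₁₂ = 0` on the screen, `Λ₁₂(⊗_f phi_f) = 12Ψ` as a ring
identity). THIS FILE instantiates that frame on the objects the tree has: the 𝔅(μ₄) cells `MCell` and configurations `MConfig`
of `Pad4TowerCrossPhase`, and the class-y designs `Pad4FirstOrderModel.Design` of FILE A with `Pad4TowerPsi`'s Ψ — turning the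
cell's LEMMA Ψ ⊂ (A1) (bc5-plan g6 IDEATOR LINE 1, cell INBOX l.31721 2026-08-27T23:22Z, `IDEATOR-LINE1-PsiSubA1.md`
5898767b36f71778, pencil ×1 «RECEIVED» director-hodge g11 RULING W1-FINAL l.31722, machine-exact ×3) into kernel theorems, and
DISCHARGING the Ψ-row hypothesis that `Pad4TowerPsi` (LEMMA Ψ₁, FLAG F-e) and `Pad4TowerUniverseDT1` had to carry as a named
assumption («Ψ's annihilation of ℚ[h] ⊕ W (PAD4-THEOREM-L (6.5), pencil ×2) — NOT re-proved in Lean» there; re-proved here,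
modulo the frame).

CONTENT (all PROVED; no `sorry`; axioms standard).
* §1 `psiTwelve_eq_psiForm`: the frame's `psiTwelve` is `12 · Pad4TowerPsi.psiForm`.
* §2 ON 𝔅(μ₄). `bphi x = (1, α, α, β, β̄, α² − |β|²) ∈ ℤ[i]⁶` for a factor point `x = (α, Re β, Im β)` (pad4lib `phi(blk(α,α,β))`,
  w1h1 `phi_letter`); `MCell.ch` (the class tensor of a cell, w1h1 `tensor_of`); `MCell.psi12` ∕ **`MCell.psiQ`** (xres2s.py
  4c2f24881a6c7580 l.277–281 `psi`, verbatim: `a = α_f`, `s = re² + im²`, three pairings, `∕12`); **`MCell.lamTwelve_ch`: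
  `Λ₁₂(ch Z) = 12Ψ(Z)`** for every cell; `MConfig.wch` (the weighted class tensor `Σ_N m_N ch(N) − Σ_P m_P ch(P)`, integer
  multiplicities per side = w1h1's `Σ_c sgn_c m_c T_c` up to the overall sign); **`MConfig.psiRow_of_classScreen`: (A1) with
  multiplicities ⇒ `Σ_N m_N Ψ(N) = Σ_P m_P Ψ(P)`**; the FULL variant's **Ψ-CLAUSE `MConfig.PsiClause`** typed literally from
  xres2s.py l.680–685 `with_psi` (signed Ψ: `+Ψ` on `N`, `−Ψ` on `P`; a present positive forces a present negative and conversely;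
  `HasPsiPos`, `HasPsiNeg`); **`MConfig.psiClause_of_psiRow`** (positive multiplicities) and **`MConfig.psiClause_of_classScreen`:
  for EVERY multiplicity vector `m ≥ 1`, (A1) ⇒ the Ψ-clause** — so a support violating the Ψ-clause is (A1)-infeasible for all
  multiplicities (bc5-plan g6 item 3, the premise of the W1 ◇₈ corollary).
* §3 ON FILE A. `Constituent.ch` (via the seam `mcellOfConstituent`: factor points `(t + c_f, c_f ζ̄_f)`; so the letter vector is
  `(1, t + c_f, t + c_f, c_f ζ̄_f, c_f ζ_f, t² + 2tc_f)` = PAD4-THEOREM-L (6.5)'s «[1] = 1, [u] = [v] = t + c_f, [e] = c_f ζ̄_f,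
  [E] = c_f ζ_f, [p] = det = t² + 2tc_f»); **`Constituent.ch_eWord`: the `eeee`-coefficient IS FILE A's `muTerm = Π_f β_f`**, and
  **`Design.ch_eWord`: the design's `eeee`-coefficient IS FILE A's μ-word `Design.mu`** (so FILE A's `H1 : μ ≠ 0` is the
  `W`-coordinate statement of the same tensor); `Constituent.beta_re_sq_add_im_sq` (`|c ζ̄|² = c²`), **`Constituent.psiQ_mcell`:
  the cell-level Ψ across the seam is `Pad4TowerPsi`'s `Constituent.psi`**; `Design.ch` (`Σ_N ch − Σ_P ch`, multiplicity by
  repetition), **`Design.ClassCondition := ClassScreen D.ch`** — the class condition `ch(E) ∈ ℚ[h] ⊕ W` of PAD4-FIRSTORDER §0 (H1)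
  that FILE A's §FAITHFULNESS (d) does not impose, stated in the frame; **`Design.psiBalanced_of_classCondition :
  D.ClassCondition → D.PsiBalanced`**; hence LEMMA Ψ₁ from (A1): `Design.not_H1_of_classCondition_of_upper ∕ _of_lower`,
  `Design.exists_fc_both_levels_of_classCondition` ((A1) + (H1) ⇒ fully charged constituents on BOTH levels — (6.5)'s sentence).
* §4 kernel probes (`decide`): `psiQ_probes` (the values −2∕3, 1, 32∕3 of `Pad4TowerPsi` §4 re-read on genuinely four-phase cells —
  Ψ is phase-blind); `fcCell_coeffs` (`ch[ℓ₁|ℓ₋ᵢ|ℓ₋₁|ℓ_i]`: `[uuuu] = 1`, `[pp11] = 0`, `μ = [eeee] = −1`); `not_classScreen_fcCell`: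
  THE SCREEN HAS TEETH — a lone fully charged class fails (A1) (cf. LEMMA FC-CORE: under (A1) a lone FC class is impossible).

CONVENTIONS (hostile read s4-ref g85, cell INBOX l.31811 ∕ l.31814, precisions P1). (a) The `e`-slot of this frame is `[e] = β = c ζ̄`
(FILE A `Constituent.beta`, `Pad4TowerLlite.bpointOfConstituent`, PAD4-THEOREM-L (6.5)∕(6.6)), whence `Design.ch_eWord = Design.mu` below;
the kernel LEMMA FC-CORE (`Pad4FCCore`, key 840) and pad4lib's W-SEARCH blocks carry `β = c·i^k` in the `e`-slot — the complex-conjugate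
labelling («the conjugate labelling changes nothing», (6.5)). Everything in this file is `e ↔ ē` symmetric (Λ is e-free, the screen treats
`eeee` and `ēēēē` alike), so no statement here depends on the choice; a future seam between `Design.mu` and `Pad4FCCore`'s μ needs a `star`.
(b) bc5-plan g6's placement averages `avg₁₂[1 p u u]`, `avg₆[1 1 p p]` are the `S₄`-orbit averages of those words, so `Λ` IS (6.5)'s
`Ψ := avg_{S₄}([uuuu] − 2[1puu] + [11pp])` and `lamTwelve = 12Λ`.

WHAT IS NOT HERE ∕ NOT IN LEAN. The identification of the word algebra with `H^{ev}(S⁴)` and of `ℚ[h] ⊕ W` with the subspace of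
PAD4-FIRSTORDER §0 (the cell's frame: gs-eng-2 g44 §11, PAD4-THEOREM-L (6.5)∕(6.6), pencil ×2 — the modelling sentence, as for the
kernel LEMMA FC-CORE `Pad4FCCore`); the W1 ◇₈ corollary itself (a SAT verdict FULL UNSAT ×2, kit jobs — not a Lean statement);
RULE D, (E1), X-cleanliness (sibling files). (A1) here is the class screen WITHOUT pad4lib's `μ̄ = conj μ` clause (weaker
hypothesis; for integral designs it holds anyway). No variety, sheaf, σ, seed or abelian variety; NOTHING HERE SAYS THAT HC ∕ HC_CM ∕
HC_AV ∕ W₆ ∕ HC_Kum4Type HOLDS OR FAILS. No `instance`, no notation, no named fact, 0 `sorry`.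

SOURCES (sha16): IDEATOR-LINE1-PsiSubA1.md 5898767b36f71778; psi_identity_check.py aa239a054d483cc8; psi_tensor_crosscheck.py
273eb713d035f842; gs-eng-2 g51 psi_x3.py 80a63931811c3cf7 (cell INBOX l.31726); pad4lib.py 298d123426f6a4be; w1h1.py
822105c02c0c27a3; xres2s.py 4c2f24881a6c7580 (l.277–281 `psi`, l.680–685 `with_psi`); PAD4-THEOREM-L-search-1.md 7011a711a54d33d2
(6.5); tree files `Pad4TowerPsi.lean` b23c6bbb35c2be0c (p-id of key 746), `Pad4TowerCrossPhase.lean` 8f09792281b0723a (755),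
`Pad4FirstOrderModel.lean` b6b3015efa20709e (FILE A), `Pad4TowerLlite.lean` 60030679fa008459 (`BPoint`, `bpointOfConstituent`).
-/

namespace Summit.Ventures.HSemireg.Pad4Tower

open Finset Summit.Ventures.HSemireg.Pad4FirstOrder

/-! ## §1 The frame's `12Ψ` is `Pad4TowerPsi`'s closed form -/

/-- consistency with `Pad4TowerPsi`: `psiTwelve = 12 · psiForm` over `ℚ`. -/
theorem psiTwelve_eq_psiForm (α s : Fin 4 → ℚ) : psiTwelve α s = 12 * psiForm α s := by
  simp only [psiTwelve, psiForm, pairTerm]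
  ring

/-! ## §2 On 𝔅(μ₄): the class tensor of a cell over `ℤ[i]`, its Ψ, the Ψ-row and the encoder's Ψ-clause -/

/-- the letter vector of a balanced factor point `x = (α, Re β, Im β)`: `(1, α, α, β, β̄, α² − |β|²) ∈ ℤ[i]⁶`
(pad4lib `phi(blk(α, α, β))`; w1h1 `phi_letter`). -/
def bphi (x : BPoint) : Fin 6 → GaussianInt :=
  phiVec (x.1 : GaussianInt) ⟨x.2.1, x.2.2⟩ ⟨x.2.1, -x.2.2⟩ ((x.1 ^ 2 - x.2.1 ^ 2 - x.2.2 ^ 2 : ℤ) : GaussianInt)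

/-- the CLASS TENSOR `ch(Z)` of a 𝔅(μ₄) cell (w1h1 `tensor_of`: one balanced block per factor). -/
def MCell.ch (Z : MCell) : CWord → GaussianInt := chTensor fun f => bphi (Z f)

/-- `12·Ψ(Z)` of a cell, an integer (`a_f = α_f`, `s_f = (Re β_f)² + (Im β_f)²`; xres2s.py `psi` ×12). -/
def MCell.psi12 (Z : MCell) : ℤ := psiTwelve (fun f => (Z f).1) (fun f => (Z f).2.1 ^ 2 + (Z f).2.2 ^ 2)

/-- `Ψ(Z)` of a cell (xres2s.py l.277–281 `psi`, verbatim: `a = [α_f]`, `s = [re² + im²]`, three pairings, `∕12`),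
through `Pad4TowerPsi.psiForm`. -/
def MCell.psiQ (Z : MCell) : ℚ :=
  psiForm (fun f => ((Z f).1 : ℚ)) (fun f => ((Z f).2.1 : ℚ) ^ 2 + ((Z f).2.2 : ℚ) ^ 2)

/-- `psi12 = 12 · psiQ`. -/
theorem MCell.psi12_cast (Z : MCell) : (Z.psi12 : ℚ) = 12 * Z.psiQ := by
  rw [MCell.psiQ, ← psiTwelve_eq_psiForm, MCell.psi12, show ((psiTwelve _ _ : ℤ) : ℚ) =
    Int.castRingHom ℚ (psiTwelve _ _) from rfl, map_psiTwelve]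
  simp

/-- **`Λ₁₂(ch(Z)) = 12Ψ(Z)`** for every 𝔅(μ₄) cell (the identity `lamTwelve_chTensor_phiVec` at `p = α² − |β|²`). -/
theorem MCell.lamTwelve_ch (Z : MCell) : lamTwelve Z.ch = (Z.psi12 : GaussianInt) := by
  rw [MCell.ch, show (fun f => bphi (Z f)) = fun f => phiVec ((Z f).1 : GaussianInt) ⟨(Z f).2.1, (Z f).2.2⟩
      ⟨(Z f).2.1, -(Z f).2.2⟩ (((Z f).1 ^ 2 - (Z f).2.1 ^ 2 - (Z f).2.2 ^ 2 : ℤ) : GaussianInt) from rfl,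
    lamTwelve_chTensor_phiVec, MCell.psi12,
    show ((psiTwelve _ _ : ℤ) : GaussianInt) = Int.castRingHom GaussianInt (psiTwelve _ _) from rfl, map_psiTwelve]
  congr 1
  funext f
  simp only [eq_intCast, Int.cast_sub, Int.cast_pow, Int.cast_add]
  ring

/-- the WEIGHTED CLASS TENSOR of a configuration with integer multiplicities per side:
`Σ_{N ∈ E₋} m_N ch(N) − Σ_{P ∈ E₊} m_P ch(P)` (w1h1's `Σ_c sgn_c m_c T_c` up to the overall sign — there `sgn N = −1, P = +1`;
FILE A's orientation `μ = Σ_N − Σ_P`). -/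
def MConfig.wch (C : MConfig) (mN mP : MCell → ℤ) : CWord → GaussianInt :=
  ∑ Z ∈ C.lower, mN Z • Z.ch - ∑ P ∈ C.upper, mP P • P.ch

/-- **THE Ψ-ROW on 𝔅(μ₄)** (bc5-plan g6 item 3): if the weighted class tensor passes the class screen ((A1) with
multiplicities `m`), then `Σ_N m_N Ψ(N) = Σ_P m_P Ψ(P)`. -/
theorem MConfig.psiRow_of_classScreen (C : MConfig) (mN mP : MCell → ℤ) (h : ClassScreen (C.wch mN mP)) :
    ∑ Z ∈ C.lower, (mN Z : ℚ) * Z.psiQ = ∑ P ∈ C.upper, (mP P : ℚ) * P.psiQ := by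
  have h0 := lamTwelve_eq_zero_of_classScreen _ h
  simp only [MConfig.wch, map_sub, map_sum, map_zsmul, MCell.lamTwelve_ch] at h0
  simp only [zsmul_eq_mul] at h0
  have h1 : ((∑ Z ∈ C.lower, mN Z * Z.psi12 - ∑ P ∈ C.upper, mP P * P.psi12 : ℤ) : GaussianInt) = 0 := by
    push_cast
    exact h0
  have h2 : (((∑ Z ∈ C.lower, mN Z * Z.psi12 - ∑ P ∈ C.upper, mP P * P.psi12 : ℤ)) : ℚ) = 0 := by
    rw [Int.cast_eq_zero.1 h1, Int.cast_zero]
  push_cast [MCell.psi12_cast] at h2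
  have h3 : (12 : ℚ) * (∑ Z ∈ C.lower, (mN Z : ℚ) * Z.psiQ - ∑ P ∈ C.upper, (mP P : ℚ) * P.psiQ) = 0 := by
    rw [mul_sub, Finset.mul_sum, Finset.mul_sum]
    convert h2 using 3 <;> simp [mul_left_comm]
  linarith

/-- a positive SIGNED Ψ is present: an `N`-cell with `Ψ > 0` or a `P`-cell with `Ψ < 0` (xres2s.py `pos`: signed Ψ = `PSI`
on `N`, `−PSI` on `P`). Decidable. -/
abbrev MConfig.HasPsiPos (C : MConfig) : Prop := (∃ Z ∈ C.lower, 0 < Z.psiQ) ∨ ∃ P ∈ C.upper, P.psiQ < 0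

/-- a negative signed Ψ is present (xres2s.py `neg`). Decidable. -/
abbrev MConfig.HasPsiNeg (C : MConfig) : Prop := (∃ Z ∈ C.lower, Z.psiQ < 0) ∨ ∃ P ∈ C.upper, 0 < P.psiQ

/-- **THE Ψ-CLAUSE OF THE FULL VARIANT** (xres2s.py l.680–685 `with_psi`, typed literally: `pv → some pos present`,
`nv → some neg present`, `pos present → nv`, `neg present → pv`): on the support, a present positive signed Ψ forces a present
negative one, and conversely («the signed Ψ-values on S are all zero or take BOTH strict signs»). Decidable. -/
abbrev MConfig.PsiClause (C : MConfig) : Prop := (C.HasPsiPos → C.HasPsiNeg) ∧ (C.HasPsiNeg → C.HasPsiPos)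

/-- the Ψ-row with POSITIVE multiplicities implies the Ψ-clause (a zero sum of positively weighted signed values is all-zero
or two-signed). -/
theorem MConfig.psiClause_of_psiRow (C : MConfig) (mN mP : MCell → ℤ) (hN : ∀ Z ∈ C.lower, 0 < mN Z)
    (hP : ∀ P ∈ C.upper, 0 < mP P)
    (hrow : ∑ Z ∈ C.lower, (mN Z : ℚ) * Z.psiQ = ∑ P ∈ C.upper, (mP P : ℚ) * P.psiQ) : C.PsiClause := by
  constructor
  · intro hpos
    by_contra hneg
    simp only [MConfig.HasPsiNeg, not_or, not_exists, not_and, not_lt] at hneg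
    have hl : ∀ Z ∈ C.lower, 0 ≤ (mN Z : ℚ) * Z.psiQ := fun Z hZ =>
      mul_nonneg (by exact_mod_cast (hN Z hZ).le) (hneg.1 Z hZ)
    have hu : ∀ P ∈ C.upper, (mP P : ℚ) * P.psiQ ≤ 0 := fun P hP' =>
      mul_nonpos_of_nonneg_of_nonpos (by exact_mod_cast (hP P hP').le) (hneg.2 P hP')
    rcases hpos with ⟨Z, hZ, hZp⟩ | ⟨P, hPm, hPn⟩
    · have h1 : 0 < (mN Z : ℚ) * Z.psiQ := mul_pos (by exact_mod_cast hN Z hZ) hZp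
      have h2 : (mN Z : ℚ) * Z.psiQ ≤ ∑ Z ∈ C.lower, (mN Z : ℚ) * Z.psiQ := Finset.single_le_sum hl hZ
      have h3 : ∑ P ∈ C.upper, (mP P : ℚ) * P.psiQ ≤ 0 := Finset.sum_nonpos hu
      linarith
    · have h1 : (mP P : ℚ) * P.psiQ < 0 := mul_neg_of_pos_of_neg (by exact_mod_cast hP P hPm) hPn
      have h2 : ∑ P ∈ C.upper, (mP P : ℚ) * P.psiQ - (mP P : ℚ) * P.psiQ ≤ 0 := by
        rw [← Finset.sum_erase_eq_sub hPm]
        exact Finset.sum_nonpos fun x hx => hu x (Finset.mem_of_mem_erase hx)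
      have h3 : 0 ≤ ∑ Z ∈ C.lower, (mN Z : ℚ) * Z.psiQ := Finset.sum_nonneg hl
      linarith
  · intro hneg
    by_contra hpos
    simp only [MConfig.HasPsiPos, not_or, not_exists, not_and, not_lt] at hpos
    have hl : ∀ Z ∈ C.lower, (mN Z : ℚ) * Z.psiQ ≤ 0 := fun Z hZ =>
      mul_nonpos_of_nonneg_of_nonpos (by exact_mod_cast (hN Z hZ).le) (hpos.1 Z hZ)
    have hu : ∀ P ∈ C.upper, 0 ≤ (mP P : ℚ) * P.psiQ := fun P hP' =>
      mul_nonneg (by exact_mod_cast (hP P hP').le) (hpos.2 P hP')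
    rcases hneg with ⟨Z, hZ, hZn⟩ | ⟨P, hPm, hPp⟩
    · have h1 : (mN Z : ℚ) * Z.psiQ < 0 := mul_neg_of_pos_of_neg (by exact_mod_cast hN Z hZ) hZn
      have h2 : ∑ Z ∈ C.lower, (mN Z : ℚ) * Z.psiQ - (mN Z : ℚ) * Z.psiQ ≤ 0 := by
        rw [← Finset.sum_erase_eq_sub hZ]
        exact Finset.sum_nonpos fun x hx => hl x (Finset.mem_of_mem_erase hx)
      have h3 : 0 ≤ ∑ P ∈ C.upper, (mP P : ℚ) * P.psiQ := Finset.sum_nonneg hu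
      linarith
    · have h1 : 0 < (mP P : ℚ) * P.psiQ := mul_pos (by exact_mod_cast hP P hPm) hPp
      have h2 : (mP P : ℚ) * P.psiQ ≤ ∑ P ∈ C.upper, (mP P : ℚ) * P.psiQ := Finset.single_le_sum hu hPm
      have h3 : ∑ Z ∈ C.lower, (mN Z : ℚ) * Z.psiQ ≤ 0 := Finset.sum_nonpos hl
      linarith

/-- **KERNEL LEMMA Ψ ⊂ (A1) on 𝔅(μ₄)**: for every finite configuration and every choice of multiplicities `m ≥ 1` per present
class, (A1) — the weighted class tensor passes the class screen — implies the Ψ-clause of the FULL variant. Hence a support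
violating the Ψ-clause is (A1)-infeasible for EVERY multiplicity vector (bc5-plan g6 item 3 and its W1 corollary's premise). -/
theorem MConfig.psiClause_of_classScreen (C : MConfig) (mN mP : MCell → ℤ) (hN : ∀ Z ∈ C.lower, 0 < mN Z)
    (hP : ∀ P ∈ C.upper, 0 < mP P) (h : ClassScreen (C.wch mN mP)) : C.PsiClause :=
  C.psiClause_of_psiRow mN mP hN hP (C.psiRow_of_classScreen mN mP h)

/-! ## §3 On FILE A designs: the μ-word is the `eeee`-coefficient; the class condition forces `Design.PsiBalanced` -/

/-- the class tensor of a FILE A constituent `t·h + Σ_f c_f ℓ_{ζ_f}`: the tensor of its 𝔅(μ₄) cell (FILE-A seam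
`mcellOfConstituent`: factor points `(t + c_f, c_f ζ̄_f)`). -/
def _root_.Summit.Ventures.HSemireg.Pad4FirstOrder.Constituent.ch (X : Constituent) : CWord → GaussianInt :=
  (mcellOfConstituent X).ch

/-- **the frame's `eeee`-coefficient of a constituent IS FILE A's `muTerm = Π_f β_f`.** -/
theorem _root_.Summit.Ventures.HSemireg.Pad4FirstOrder.Constituent.ch_eWord (X : Constituent) :
    X.ch eWord = X.muTerm := by
  simp only [Constituent.ch, MCell.ch, chTensor, bphi, phiVec, eWord, mcellOfConstituent, bpointOfConstituent,
    Constituent.muTerm, Fin.prod_univ_four]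
  simp only [Matrix.cons_val]

/-- the squared modulus of `β_f = c_f ζ̄_f` is `c_f²` (`|ζ| = 1`, `ζ ∈ μ₄`). -/
theorem _root_.Summit.Ventures.HSemireg.Pad4FirstOrder.Constituent.beta_re_sq_add_im_sq (X : Constituent)
    (f : Fin 4) : (X.beta f).re ^ 2 + (X.beta f).im ^ 2 = (X.charge f : ℤ) ^ 2 := by
  unfold Constituent.beta Constituent.zetaG
  generalize X.phase f = k
  fin_cases k <;> simp [pow_succ]

/-- **Ψ agrees across the seam**: the cell-level Ψ of a constituent's cell is `Pad4TowerPsi`'s `Constituent.psi`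
(`α_f = t + c_f`, `s_f = |β_f|² = c_f²`). -/
theorem _root_.Summit.Ventures.HSemireg.Pad4FirstOrder.Constituent.psiQ_mcell (X : Constituent) :
    (mcellOfConstituent X).psiQ = X.psi := by
  have hs : ∀ f, (((X.beta f).re : ℚ) ^ 2 + ((X.beta f).im : ℚ) ^ 2) = (X.charge f : ℚ) ^ 2 := fun f => by
    exact_mod_cast X.beta_re_sq_add_im_sq f
  simp only [MCell.psiQ, mcellOfConstituent, bpointOfConstituent, Constituent.psi, Int.cast_add, Int.cast_natCast, hs]

/-- the CLASS TENSOR of a FILE A design: `Σ_N ch(N) − Σ_P ch(P)` (multiplicity by repetition, FILE A's orientation). -/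
def _root_.Summit.Ventures.HSemireg.Pad4FirstOrder.Design.ch (D : Design) : CWord → GaussianInt :=
  (D.lower.map Constituent.ch).sum - (D.upper.map Constituent.ch).sum

/-- **the `eeee`-coefficient of the design's class tensor IS FILE A's μ-word** (so FILE A's `H1 : μ ≠ 0` is the statement
«the `W`-coordinate `eeee` of `ch(E)` is non-zero» in the frame). -/
theorem _root_.Summit.Ventures.HSemireg.Pad4FirstOrder.Design.ch_eWord (D : Design) : D.ch eWord = D.mu := by
  simp only [Design.ch, Design.mu, Pi.sub_apply, Pi.list_sum_apply, List.map_map, Function.comp_def,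
    Constituent.ch_eWord]

/-- **THE CLASS CONDITION (A1) of a FILE A design** — `ch(E) ∈ ℚ[h] ⊕ W` of PAD4-FIRSTORDER §0 (H1), which FILE A does NOT
impose (its §FAITHFULNESS (d)) — stated in the frame of record: the design's class tensor passes the class screen. -/
def _root_.Summit.Ventures.HSemireg.Pad4FirstOrder.Design.ClassCondition (D : Design) : Prop := ClassScreen D.ch

/-- `Λ₁₂` of a constituent's class tensor is `12Ψ`. -/
theorem _root_.Summit.Ventures.HSemireg.Pad4FirstOrder.Constituent.lamTwelve_ch (X : Constituent) :
    lamTwelve X.ch = ((mcellOfConstituent X).psi12 : GaussianInt) :=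
  (mcellOfConstituent X).lamTwelve_ch

/-- **KERNEL LEMMA Ψ ⊂ (A1), FILE A form: the class condition implies the Ψ-row `Design.PsiBalanced`** — the named
hypothesis of LEMMA Ψ₁ (`Pad4TowerPsi`, FLAG F-e) is DISCHARGED by (A1). -/
theorem _root_.Summit.Ventures.HSemireg.Pad4FirstOrder.Design.psiBalanced_of_classCondition (D : Design)
    (h : D.ClassCondition) : D.PsiBalanced := by
  have h0 := lamTwelve_eq_zero_of_classScreen _ h
  rw [Design.ch, map_sub, map_list_sum, map_list_sum, List.map_map, List.map_map] at h0
  have e : (⇑(lamTwelve (R := GaussianInt)) ∘ Constituent.ch) =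
      fun X => (((mcellOfConstituent X).psi12 : ℤ) : GaussianInt) := funext fun X => X.lamTwelve_ch
  rw [e] at h0
  have h1 : (((D.lower.map fun X => (mcellOfConstituent X).psi12).sum -
      (D.upper.map fun X => (mcellOfConstituent X).psi12).sum : ℤ) : GaussianInt) = 0 := by
    push_cast [List.map_map, Function.comp_def]
    exact h0
  have h2 : (((D.lower.map fun X => (mcellOfConstituent X).psi12).sum -
      (D.upper.map fun X => (mcellOfConstituent X).psi12).sum : ℤ) : ℚ) = 0 := by
    rw [Int.cast_eq_zero.1 h1, Int.cast_zero]
  push_cast [List.map_map, Function.comp_def, MCell.psi12_cast, Constituent.psiQ_mcell] at h2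
  have hl : ∀ l : List Constituent, (l.map fun X => (12 : ℚ) * X.psi).sum = 12 * psiSum l := fun l => by
    rw [psiSum, List.sum_map_mul_left]
  rw [hl, hl] at h2
  unfold Design.PsiBalanced
  linarith

/-- **LEMMA Ψ₁ from the class condition** (was: from the Ψ-row hypothesis): a class-y design satisfying (A1) whose `P`-level
has no fully charged constituent violates (H1). -/
theorem _root_.Summit.Ventures.HSemireg.Pad4FirstOrder.Design.not_H1_of_classCondition_of_upper (D : Design)
    (h : D.ClassCondition) (hP : ∀ X ∈ D.upper, X.nCharged ≠ 4) : ¬ D.H1 :=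
  D.not_H1_of_psiBalanced_of_upper (D.psiBalanced_of_classCondition h) hP

/-- the mirror statement (no fully charged `N`). -/
theorem _root_.Summit.Ventures.HSemireg.Pad4FirstOrder.Design.not_H1_of_classCondition_of_lower (D : Design)
    (h : D.ClassCondition) (hN : ∀ X ∈ D.lower, X.nCharged ≠ 4) : ¬ D.H1 :=
  D.not_H1_of_psiBalanced_of_lower (D.psiBalanced_of_classCondition h) hN

/-- under (A1), (H1) needs fully charged constituents on BOTH levels. -/
theorem _root_.Summit.Ventures.HSemireg.Pad4FirstOrder.Design.exists_fc_both_levels_of_classCondition (D : Design)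
    (h : D.ClassCondition) (h1 : D.H1) :
    (∃ X ∈ D.lower, X.nCharged = 4) ∧ (∃ X ∈ D.upper, X.nCharged = 4) :=
  D.exists_fc_both_levels_of_H1 (D.psiBalanced_of_classCondition h) h1

/-! ## §4 Kernel probes -/

/-- the cell-level Ψ reproduces the values of record (`Pad4TowerPsi` §4), read on μ₄ cells with mixed phases (Ψ is
phase-blind; `lpt 1 k = ℓ_{i^k}`): `Ψ[O|ℓ₁|ℓ₋ᵢ|2I] = −2∕3`, `Ψ[ℓ₁|ℓ₋ᵢ|ℓ₋₁|ℓ_i] = 1`, `Ψ[O|O|2I+ℓ₋ᵢ|2I+ℓ₋₁] = 32∕3`.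
[kernel, `decide`] -/
theorem psiQ_probes :
    MCell.psiQ (mcellOf (0, 0, 0) (lpt 1 0) (lpt 1 3) (2, 0, 0)) = -2 / 3 ∧
    MCell.psiQ (mcellOf (lpt 1 0) (lpt 1 3) (lpt 1 2) (lpt 1 1)) = 1 ∧
    MCell.psiQ (mcellOf (0, 0, 0) (0, 0, 0) (ray (2, 0, 0) 3 1) (ray (2, 0, 0) 2 1)) = 32 / 3 := by
  decide +kernel

/-- the fully charged four-phase cell `[ℓ₁|ℓ₋ᵢ|ℓ₋₁|ℓ_i]` (`lpt 1 k = ℓ_{i^k}`, `β = ζ̄`). -/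
def fcCell : MCell := mcellOf (lpt 1 0) (lpt 1 3) (lpt 1 2) (lpt 1 1)

/-- two e-free degree-4 coefficients of `ch[ℓ₁|ℓ₋ᵢ|ℓ₋₁|ℓ_i]`: `[uuuu] = 1`, `[p p 1 1] = 0` (`p = α² − |β|² = 0` on a unit
null letter); and its `eeee`-coefficient `μ = Π_f β_f = 1·i·(−1)·(−i) = −1`. [kernel, `decide`] -/
theorem fcCell_coeffs : fcCell.ch ![1, 1, 1, 1] = 1 ∧ fcCell.ch ![5, 5, 0, 0] = 0 ∧ fcCell.ch eWord = -1 := by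
  decide +kernel

/-- THE SCREEN HAS TEETH: the one-class `N`-support `{[ℓ₁|ℓ₋ᵢ|ℓ₋₁|ℓ_i]}` (multiplicity `1`) fails the class screen — two
e-free degree-4 coefficients differ. -/
theorem not_classScreen_fcCell : ¬ ClassScreen ((⟨{fcCell}, ∅⟩ : MConfig).wch (fun _ => 1) fun _ => 1) := by
  intro h
  have h1 : (⟨{fcCell}, ∅⟩ : MConfig).wch (fun _ => 1) (fun _ => 1) ![1, 1, 1, 1] =
      (⟨{fcCell}, ∅⟩ : MConfig).wch (fun _ => 1) (fun _ => 1) ![5, 5, 0, 0] :=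
    h.2 _ _ (by decide) (by decide) (by decide)
  simp [MConfig.wch, fcCell_coeffs.1, fcCell_coeffs.2.1] at h1

end Summit.Ventures.HSemireg.Pad4Tower
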